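import Summits.KontsevichZagierPeriods.KontsevichZagierPeriods.Theorems.HurwitzMicroSectorsHurwitzSectorComplementStubLadderDescentSteps
import Summits.KontsevichZagierPeriods.KontsevichZagierPeriods.Theorems.HurwitzMicroSectorsHurwitzSectorComplementStubLadderEngine

/-!
# `HurwitzSectorComplement` (stmt-KontsevichZagierPeriods-14341), line `chebyshev-level-deformation`,
# stub S3 `stub_ladderDescent` — the descent (siege k2: induction on the odd box dimension)

Def-free; proves the registered stub S3 BY NAME AND SIGNATURE from the landed parts 1–3
(`…StubLadderDescentAlgebra/Engine/Steps`): `step_U` (`𝔘_{m+2,·} ⇐ 𝔗_{m+1,·}`, one U-step of the engine),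
`step_odd` (`𝔘_{N+1,·} ⟹ 𝔘_{N+3,·}` through `𝔗_{N+2,·}`, `ζ_{N+2}` = the ladder at `v₀ = 1` plus the level-4
sector reduction — the one-variable dilation algebra that also closes `SectorTwoSix` — and the arcs S2a),
`uFamily_odd` (induction on `N` from the bottom cell S2b), then (C3) `step_zeta`, (C4) `conc_inv`, (C1) `conc_T`,
(C2) `ladder_U0` + `step_T`. Bernoulli parity closes the induction (T-objects in even, U-objects in odd box
dimension; only U-objects reach `m = 1`). Registered sub-goal: `ladderDescent_uDescent` (the U-step, with the
landed engine `stub_ladderEngine`). References: M. Kontsevich, D. Zagier, *Periods* (2001), §1.2.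
-/

noncomputable section

open Set MeasureTheory
open scoped BigOperators
open Literature.NumberTheory.Transcendental
open Literature.ModelTheory.ExponentialFields (IsSemialgebraic)

namespace Summit.KontsevichZagierPeriods.Theorems.HurwitzMicroSectorsHurwitzSectorComplement

namespace LadderDescentK2

open LadderDescent

/-- The family of U-objects `𝔘_{n,k+1}` (all `k`, all cyclotomic `v₀ = tan(πj/L)`) "lies in `ℚ·𝔭`",
transported along a propositional equality `n = n'` of box dimensions. [folklore] -/
theorem uFamily_congr (n n' : ℕ) (h : n = n')
    (H : ∀ (k j L : ℕ), 0 < j → 2 * j < L → ∀ (r : KZ.IntegralRep (n + (k + 1))),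
      r.domain = {z | (∀ i : Fin n, z (Fin.castAdd (k + 1) i) ∈ Set.Ioo (0:ℝ) 1) ∧
        (∀ i : Fin (k + 1), 0 < z (Fin.natAdd n i) ∧ z (Fin.natAdd n i) < Real.tan (Real.pi * j / L)) ∧
        (∀ i i' : Fin (k + 1), i < i' → z (Fin.natAdd n i) < z (Fin.natAdd n i'))} →
      Set.EqOn r.integrand (fun z => (∏ i : Fin (k + 1), 2 / (1 + (z (Fin.natAdd n i)) ^ 2)) *
        (2 * z (Fin.natAdd n 0) /
          ((1 - ∏ i : Fin n, z (Fin.castAdd (k + 1) i)) ^ 2 + (z (Fin.natAdd n 0)) ^ 2 * (1 + ∏ i : Fin n, z (Fin.castAdd (k + 1) i)) ^ 2))) r.domain →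
      ∃ q : ℚ, ∀ (s : KZ.IntegralRep (n + (k + 1))), s.domain = {x | ∀ i, x i ∈ Set.Ioo (0:ℝ) 1} →
        Set.EqOn s.integrand (fun x => (q : ℝ) * ∏ i, 2 / (1 + (x i) ^ 2)) s.domain →
        KZ.Equivalent r s) :
    ∀ (k j L : ℕ), 0 < j → 2 * j < L → ∀ (r : KZ.IntegralRep (n' + (k + 1))),
      r.domain = {z | (∀ i : Fin n', z (Fin.castAdd (k + 1) i) ∈ Set.Ioo (0:ℝ) 1) ∧
        (∀ i : Fin (k + 1), 0 < z (Fin.natAdd n' i) ∧ z (Fin.natAdd n' i) < Real.tan (Real.pi * j / L)) ∧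
        (∀ i i' : Fin (k + 1), i < i' → z (Fin.natAdd n' i) < z (Fin.natAdd n' i'))} →
      Set.EqOn r.integrand (fun z => (∏ i : Fin (k + 1), 2 / (1 + (z (Fin.natAdd n' i)) ^ 2)) *
        (2 * z (Fin.natAdd n' 0) /
          ((1 - ∏ i : Fin n', z (Fin.castAdd (k + 1) i)) ^ 2 + (z (Fin.natAdd n' 0)) ^ 2 * (1 + ∏ i : Fin n', z (Fin.castAdd (k + 1) i)) ^ 2))) r.domain →
      ∃ q : ℚ, ∀ (s : KZ.IntegralRep (n' + (k + 1))), s.domain = {x | ∀ i, x i ∈ Set.Ioo (0:ℝ) 1} →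
        Set.EqOn s.integrand (fun x => (q : ℝ) * ∏ i, 2 / (1 + (x i) ^ 2)) s.domain →
        KZ.Equivalent r s := by
  subst h; exact H

/-- The family of T-objects `𝔗_{n,k+1}` (all `k`, all cyclotomic `v₀ = tan(πj/L)`) "lies in `ℚ·𝔭`",
transported along a propositional equality `n = n'` of box dimensions. [folklore] -/
theorem tFamily_congr (n n' : ℕ) (h : n = n')
    (H : ∀ (k j L : ℕ), 0 < j → 2 * j < L → ∀ (r : KZ.IntegralRep (n + (k + 1))),
      r.domain = {z | (∀ i : Fin n, z (Fin.castAdd (k + 1) i) ∈ Set.Ioo (0:ℝ) 1) ∧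
        (∀ i : Fin (k + 1), 0 < z (Fin.natAdd n i) ∧ z (Fin.natAdd n i) < Real.tan (Real.pi * j / L)) ∧
        (∀ i i' : Fin (k + 1), i < i' → z (Fin.natAdd n i) < z (Fin.natAdd n i'))} →
      Set.EqOn r.integrand (fun z => (∏ i : Fin (k + 1), 2 / (1 + (z (Fin.natAdd n i)) ^ 2)) *
        (((1 - ∏ i : Fin n, z (Fin.castAdd (k + 1) i)) - (z (Fin.natAdd n 0)) ^ 2 * (1 + ∏ i : Fin n, z (Fin.castAdd (k + 1) i))) /
          ((1 - ∏ i : Fin n, z (Fin.castAdd (k + 1) i)) ^ 2 + (z (Fin.natAdd n 0)) ^ 2 * (1 + ∏ i : Fin n, z (Fin.castAdd (k + 1) i)) ^ 2))) r.domain →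
      ∃ q : ℚ, ∀ (s : KZ.IntegralRep (n + (k + 1))), s.domain = {x | ∀ i, x i ∈ Set.Ioo (0:ℝ) 1} →
        Set.EqOn s.integrand (fun x => (q : ℝ) * ∏ i, 2 / (1 + (x i) ^ 2)) s.domain →
        KZ.Equivalent r s) :
    ∀ (k j L : ℕ), 0 < j → 2 * j < L → ∀ (r : KZ.IntegralRep (n' + (k + 1))),
      r.domain = {z | (∀ i : Fin n', z (Fin.castAdd (k + 1) i) ∈ Set.Ioo (0:ℝ) 1) ∧
        (∀ i : Fin (k + 1), 0 < z (Fin.natAdd n' i) ∧ z (Fin.natAdd n' i) < Real.tan (Real.pi * j / L)) ∧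
        (∀ i i' : Fin (k + 1), i < i' → z (Fin.natAdd n' i) < z (Fin.natAdd n' i'))} →
      Set.EqOn r.integrand (fun z => (∏ i : Fin (k + 1), 2 / (1 + (z (Fin.natAdd n' i)) ^ 2)) *
        (((1 - ∏ i : Fin n', z (Fin.castAdd (k + 1) i)) - (z (Fin.natAdd n' 0)) ^ 2 * (1 + ∏ i : Fin n', z (Fin.castAdd (k + 1) i))) /
          ((1 - ∏ i : Fin n', z (Fin.castAdd (k + 1) i)) ^ 2 + (z (Fin.natAdd n' 0)) ^ 2 * (1 + ∏ i : Fin n', z (Fin.castAdd (k + 1) i)) ^ 2))) r.domain →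
      ∃ q : ℚ, ∀ (s : KZ.IntegralRep (n' + (k + 1))), s.domain = {x | ∀ i, x i ∈ Set.Ioo (0:ℝ) 1} →
        Set.EqOn s.integrand (fun x => (q : ℝ) * ∏ i, 2 / (1 + (x i) ^ 2)) s.domain →
        KZ.Equivalent r s := by
  subst h; exact H

section Engine

variable (hT :
    (∀ (m k : ℕ) (D : Set (Fin k → ℝ)) (W lam : (Fin k → ℝ) → ℝ) (M Λ : ℝ),
      Literature.ModelTheory.ExponentialFields.IsSemialgebraic ℚ D → Bornology.IsBounded D →
      IsSemialgebraicFunOn ℚ D W → IsSemialgebraicFunOn ℚ D lam →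
      (∀ y ∈ D, |W y| ≤ M) → (∀ y ∈ D, 0 < lam y ∧ lam y ≤ Λ) →
      ∀ (r : KZ.IntegralRep (m + 2 + k)),
        r.domain = {z | (∀ i : Fin (m + 2), z (Fin.castAdd k i) ∈ Set.Ioo (0:ℝ) 1) ∧
          (fun j : Fin k => z (Fin.natAdd (m + 2) j)) ∈ D} →
        Set.EqOn r.integrand (fun z => W (fun j : Fin k => z (Fin.natAdd (m + 2) j)) *
          (((1 - ∏ i : Fin (m + 2), z (Fin.castAdd k i)) -
              (lam (fun j : Fin k => z (Fin.natAdd (m + 2) j))) ^ 2 *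
                (1 + ∏ i : Fin (m + 2), z (Fin.castAdd k i))) /
            ((1 - ∏ i : Fin (m + 2), z (Fin.castAdd k i)) ^ 2 +
              (lam (fun j : Fin k => z (Fin.natAdd (m + 2) j))) ^ 2 *
                (1 + ∏ i : Fin (m + 2), z (Fin.castAdd k i)) ^ 2))) r.domain →
        ∃ (r₁ : KZ.IntegralRep (m + 2 + k)) (r₂ : KZ.IntegralRep (m + 1 + (k + 1))),
          r₁.domain = r.domain ∧
          (r₁.integrand = fun z => W (fun j : Fin k => z (Fin.natAdd (m + 2) j)) /
            (1 - ∏ i : Fin (m + 2), z (Fin.castAdd k i))) ∧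
          r₂.domain = {z | (∀ i : Fin (m + 1), z (Fin.castAdd (k + 1) i) ∈ Set.Ioo (0:ℝ) 1) ∧
            (fun j : Fin k => z (Fin.natAdd (m + 1) j.succ)) ∈ D ∧
            0 < z (Fin.natAdd (m + 1) 0) ∧
            z (Fin.natAdd (m + 1) 0) < lam ((fun j : Fin k => z (Fin.natAdd (m + 1) j.succ)))} ∧
          (r₂.integrand = fun z => W ((fun j : Fin k => z (Fin.natAdd (m + 1) j.succ))) *
            (2 / (1 + (z (Fin.natAdd (m + 1) 0)) ^ 2)) *
            (2 * z (Fin.natAdd (m + 1) 0) /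
              ((1 - ∏ i : Fin (m + 1), z (Fin.castAdd (k + 1) i)) ^ 2 +
                (z (Fin.natAdd (m + 1) 0)) ^ 2 * (1 + ∏ i : Fin (m + 1), z (Fin.castAdd (k + 1) i)) ^ 2))) ∧
          KZ.of r - KZ.of r₁ + KZ.of r₂ ∈ KZ.relations))

variable (hU :
    (∀ (m k : ℕ) (D : Set (Fin k → ℝ)) (W lam : (Fin k → ℝ) → ℝ) (M Λ : ℝ),
      Literature.ModelTheory.ExponentialFields.IsSemialgebraic ℚ D → Bornology.IsBounded D →
      IsSemialgebraicFunOn ℚ D W → IsSemialgebraicFunOn ℚ D lam →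
      (∀ y ∈ D, |W y| ≤ M) → (∀ y ∈ D, 0 < lam y ∧ lam y ≤ Λ) →
      ∀ (r : KZ.IntegralRep (m + 2 + k)),
        r.domain = {z | (∀ i : Fin (m + 2), z (Fin.castAdd k i) ∈ Set.Ioo (0:ℝ) 1) ∧
          (fun j : Fin k => z (Fin.natAdd (m + 2) j)) ∈ D} →
        Set.EqOn r.integrand (fun z => W (fun j : Fin k => z (Fin.natAdd (m + 2) j)) *
          (2 * lam (fun j : Fin k => z (Fin.natAdd (m + 2) j)) /
            ((1 - ∏ i : Fin (m + 2), z (Fin.castAdd k i)) ^ 2 +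
              (lam (fun j : Fin k => z (Fin.natAdd (m + 2) j))) ^ 2 *
                (1 + ∏ i : Fin (m + 2), z (Fin.castAdd k i)) ^ 2))) r.domain →
        ∃ (r₂ : KZ.IntegralRep (m + 1 + (k + 1))),
          r₂.domain = {z | (∀ i : Fin (m + 1), z (Fin.castAdd (k + 1) i) ∈ Set.Ioo (0:ℝ) 1) ∧
            (fun j : Fin k => z (Fin.natAdd (m + 1) j.succ)) ∈ D ∧
            0 < z (Fin.natAdd (m + 1) 0) ∧
            z (Fin.natAdd (m + 1) 0) < lam ((fun j : Fin k => z (Fin.natAdd (m + 1) j.succ)))} ∧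
          (r₂.integrand = fun z => W ((fun j : Fin k => z (Fin.natAdd (m + 1) j.succ))) *
            (2 / (1 + (z (Fin.natAdd (m + 1) 0)) ^ 2)) *
            (((1 - ∏ i : Fin (m + 1), z (Fin.castAdd (k + 1) i)) -
                (z (Fin.natAdd (m + 1) 0)) ^ 2 * (1 + ∏ i : Fin (m + 1), z (Fin.castAdd (k + 1) i))) /
              ((1 - ∏ i : Fin (m + 1), z (Fin.castAdd (k + 1) i)) ^ 2 +
                (z (Fin.natAdd (m + 1) 0)) ^ 2 * (1 + ∏ i : Fin (m + 1), z (Fin.castAdd (k + 1) i)) ^ 2))) ∧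
          KZ.of r - KZ.of r₂ ∈ KZ.relations))

variable (hA1 :
    (∀ (a j₀ j₁ L : ℕ), j₀ < j₁ → 2 * j₁ < L → ∀ (r : KZ.IntegralRep a),
      r.domain = {y | (∀ i, Real.tan (Real.pi * j₀ / L) < y i ∧ y i < Real.tan (Real.pi * j₁ / L)) ∧
        (∀ i i' : Fin a, i < i' → y i < y i')} →
      Set.EqOn r.integrand (fun y => ∏ i, 2 / (1 + (y i) ^ 2)) r.domain →
      ∃ q : ℚ, ∀ (s : KZ.IntegralRep a), s.domain = {x | ∀ i, x i ∈ Set.Ioo (0:ℝ) 1} →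
        Set.EqOn s.integrand (fun x => (q : ℝ) * ∏ i, 2 / (1 + (x i) ^ 2)) s.domain →
        KZ.Equivalent r s))

variable (hBot : (∀ (k j L : ℕ), 0 < j → 2 * j < L → ∀ (r : KZ.IntegralRep (1 + (k + 1))),
      r.domain = {z | z (Fin.castAdd (k + 1) 0) ∈ Set.Ioo (0:ℝ) 1 ∧
        (∀ i : Fin (k + 1), 0 < z (Fin.natAdd 1 i) ∧ z (Fin.natAdd 1 i) < Real.tan (Real.pi * j / L)) ∧
        (∀ i i' : Fin (k + 1), i < i' → z (Fin.natAdd 1 i) < z (Fin.natAdd 1 i'))} →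
      Set.EqOn r.integrand (fun z => (∏ i : Fin (k + 1), 2 / (1 + (z (Fin.natAdd 1 i)) ^ 2)) *
        (2 * z (Fin.natAdd 1 0) /
          ((1 - z (Fin.castAdd (k + 1) 0)) ^ 2 +
            (z (Fin.natAdd 1 0)) ^ 2 * (1 + z (Fin.castAdd (k + 1) 0)) ^ 2))) r.domain →
      ∃ q : ℚ, ∀ (s : KZ.IntegralRep (1 + (k + 1))), s.domain = {x | ∀ i, x i ∈ Set.Ioo (0:ℝ) 1} →
        Set.EqOn s.integrand (fun x => (q : ℝ) * ∏ i, 2 / (1 + (x i) ^ 2)) s.domain →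
        KZ.Equivalent r s))

include hU in
/-- **The U-step of the descent**: `𝔘_{m+2,k+1} ∈ ℚ·𝔭 ⇐ 𝔗_{m+1,·}`. One U-step of the engine
(`LadderDescent.ladder_U`: `[W·U(y₀,p)] ≡ [W·ω(y)·T(y,p′)]`, the new parameter `y ∈ (0, y₀)` prepended
to the chain) lands on a T-object over `(0,1)^{m+1} × Δ_{k+2}(v₀)`. [cite: KontsevichZagier2001, §1.2] -/
theorem step_U (m : ℕ)
    (hTT : ∀ (k j L : ℕ), 0 < j → 2 * j < L → ∀ (r : KZ.IntegralRep (m + 1 + (k + 1))),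
      r.domain = {z | (∀ i : Fin (m + 1), z (Fin.castAdd (k + 1) i) ∈ Set.Ioo (0:ℝ) 1) ∧
        (∀ i : Fin (k + 1), 0 < z (Fin.natAdd (m + 1) i) ∧ z (Fin.natAdd (m + 1) i) < Real.tan (Real.pi * j / L)) ∧
        (∀ i i' : Fin (k + 1), i < i' → z (Fin.natAdd (m + 1) i) < z (Fin.natAdd (m + 1) i'))} →
      Set.EqOn r.integrand (fun z => (∏ i : Fin (k + 1), 2 / (1 + (z (Fin.natAdd (m + 1) i)) ^ 2)) *
        (((1 - ∏ i : Fin (m + 1), z (Fin.castAdd (k + 1) i)) - (z (Fin.natAdd (m + 1) 0)) ^ 2 * (1 + ∏ i : Fin (m + 1), z (Fin.castAdd (k + 1) i))) /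
          ((1 - ∏ i : Fin (m + 1), z (Fin.castAdd (k + 1) i)) ^ 2 + (z (Fin.natAdd (m + 1) 0)) ^ 2 * (1 + ∏ i : Fin (m + 1), z (Fin.castAdd (k + 1) i)) ^ 2))) r.domain →
      ∃ q : ℚ, ∀ (s : KZ.IntegralRep (m + 1 + (k + 1))), s.domain = {x | ∀ i, x i ∈ Set.Ioo (0:ℝ) 1} →
        Set.EqOn s.integrand (fun x => (q : ℝ) * ∏ i, 2 / (1 + (x i) ^ 2)) s.domain →
        KZ.Equivalent r s) :
    ∀ (k j L : ℕ), 0 < j → 2 * j < L → ∀ (r : KZ.IntegralRep (m + 2 + (k + 1))),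
      r.domain = {z | (∀ i : Fin (m + 2), z (Fin.castAdd (k + 1) i) ∈ Set.Ioo (0:ℝ) 1) ∧
        (∀ i : Fin (k + 1), 0 < z (Fin.natAdd (m + 2) i) ∧ z (Fin.natAdd (m + 2) i) < Real.tan (Real.pi * j / L)) ∧
        (∀ i i' : Fin (k + 1), i < i' → z (Fin.natAdd (m + 2) i) < z (Fin.natAdd (m + 2) i'))} →
      Set.EqOn r.integrand (fun z => (∏ i : Fin (k + 1), 2 / (1 + (z (Fin.natAdd (m + 2) i)) ^ 2)) *
        (2 * z (Fin.natAdd (m + 2) 0) /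
          ((1 - ∏ i : Fin (m + 2), z (Fin.castAdd (k + 1) i)) ^ 2 + (z (Fin.natAdd (m + 2) 0)) ^ 2 * (1 + ∏ i : Fin (m + 2), z (Fin.castAdd (k + 1) i)) ^ 2))) r.domain →
      ∃ q : ℚ, ∀ (s : KZ.IntegralRep (m + 2 + (k + 1))), s.domain = {x | ∀ i, x i ∈ Set.Ioo (0:ℝ) 1} →
        Set.EqOn s.integrand (fun x => (q : ℝ) * ∏ i, 2 / (1 + (x i) ^ 2)) s.domain →
        KZ.Equivalent r s := by
  intro k j L hj hjL r hdom hint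
  obtain ⟨r₂, h2d, h2i, hrel⟩ := ladder_U hU m k j L hj hjL r hdom hint
  exact inQP_cast (by omega) (inQP_of_equivalent hrel (hTT (k + 1) j L hj hjL r₂ h2d h2i))

include hT hU hA1 in
/-- **One rung of the odd ladder**: `𝔘_{N+1,·} ∈ ℚ·𝔭 ⟹ 𝔘_{N+3,·} ∈ ℚ·𝔭`. The U-step (`step_U`) lands on
`𝔗_{N+2,·}`, which one T-step reduces to `ζ_{N+2} = [(0,1)^{N+2}, 1/(1−p)]` (itself `⇐ 𝔘_{N+1,·}`
by the ladder at `v₀ = 1`, `LadderDescent.step_zeta`), the arcs S2a and `𝔘_{N+1,·}`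
(`LadderDescent.step_T`). [cite: KontsevichZagier2001, §1.2] -/
theorem step_odd (N : ℕ)
    (hUU : ∀ (k j L : ℕ), 0 < j → 2 * j < L → ∀ (r : KZ.IntegralRep (N + 1 + (k + 1))),
      r.domain = {z | (∀ i : Fin (N + 1), z (Fin.castAdd (k + 1) i) ∈ Set.Ioo (0:ℝ) 1) ∧
        (∀ i : Fin (k + 1), 0 < z (Fin.natAdd (N + 1) i) ∧ z (Fin.natAdd (N + 1) i) < Real.tan (Real.pi * j / L)) ∧
        (∀ i i' : Fin (k + 1), i < i' → z (Fin.natAdd (N + 1) i) < z (Fin.natAdd (N + 1) i'))} →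
      Set.EqOn r.integrand (fun z => (∏ i : Fin (k + 1), 2 / (1 + (z (Fin.natAdd (N + 1) i)) ^ 2)) *
        (2 * z (Fin.natAdd (N + 1) 0) /
          ((1 - ∏ i : Fin (N + 1), z (Fin.castAdd (k + 1) i)) ^ 2 + (z (Fin.natAdd (N + 1) 0)) ^ 2 * (1 + ∏ i : Fin (N + 1), z (Fin.castAdd (k + 1) i)) ^ 2))) r.domain →
      ∃ q : ℚ, ∀ (s : KZ.IntegralRep (N + 1 + (k + 1))), s.domain = {x | ∀ i, x i ∈ Set.Ioo (0:ℝ) 1} →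
        Set.EqOn s.integrand (fun x => (q : ℝ) * ∏ i, 2 / (1 + (x i) ^ 2)) s.domain →
        KZ.Equivalent r s) :
    ∀ (k j L : ℕ), 0 < j → 2 * j < L → ∀ (r : KZ.IntegralRep (N + 1 + 2 + (k + 1))),
      r.domain = {z | (∀ i : Fin (N + 1 + 2), z (Fin.castAdd (k + 1) i) ∈ Set.Ioo (0:ℝ) 1) ∧
        (∀ i : Fin (k + 1), 0 < z (Fin.natAdd (N + 1 + 2) i) ∧ z (Fin.natAdd (N + 1 + 2) i) < Real.tan (Real.pi * j / L)) ∧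
        (∀ i i' : Fin (k + 1), i < i' → z (Fin.natAdd (N + 1 + 2) i) < z (Fin.natAdd (N + 1 + 2) i'))} →
      Set.EqOn r.integrand (fun z => (∏ i : Fin (k + 1), 2 / (1 + (z (Fin.natAdd (N + 1 + 2) i)) ^ 2)) *
        (2 * z (Fin.natAdd (N + 1 + 2) 0) /
          ((1 - ∏ i : Fin (N + 1 + 2), z (Fin.castAdd (k + 1) i)) ^ 2 + (z (Fin.natAdd (N + 1 + 2) 0)) ^ 2 * (1 + ∏ i : Fin (N + 1 + 2), z (Fin.castAdd (k + 1) i)) ^ 2))) r.domain →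
      ∃ q : ℚ, ∀ (s : KZ.IntegralRep (N + 1 + 2 + (k + 1))), s.domain = {x | ∀ i, x i ∈ Set.Ioo (0:ℝ) 1} →
        Set.EqOn s.integrand (fun x => (q : ℝ) * ∏ i, 2 / (1 + (x i) ^ 2)) s.domain →
        KZ.Equivalent r s :=
  step_U hU (N + 1) (tFamily_congr (N + 2) (N + 1 + 1) rfl
    (step_T hT hA1 N (step_zeta hT N hUU) hUU))

include hT hU hA1 hBot in
/-- **The odd ladder**: for every `N`, the U-objects over `(0,1)^{2N+1} × Δ_{k+1}(tan(πj/L))` (all `k`,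
`0 < j`, `2j < L`) are rational multiples of `𝔭`. Induction on `N`: the base `𝔘_{1,·}` is the bottom
cell S2b (`LadderDescent.base_of_bottomCell`), the step is `step_odd`. [cite: KontsevichZagier2001, §1.2] -/
theorem uFamily_odd : ∀ (N k j L : ℕ), 0 < j → 2 * j < L → ∀ (r : KZ.IntegralRep (2 * N + 1 + (k + 1))),
      r.domain = {z | (∀ i : Fin (2 * N + 1), z (Fin.castAdd (k + 1) i) ∈ Set.Ioo (0:ℝ) 1) ∧
        (∀ i : Fin (k + 1), 0 < z (Fin.natAdd (2 * N + 1) i) ∧ z (Fin.natAdd (2 * N + 1) i) < Real.tan (Real.pi * j / L)) ∧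
        (∀ i i' : Fin (k + 1), i < i' → z (Fin.natAdd (2 * N + 1) i) < z (Fin.natAdd (2 * N + 1) i'))} →
      Set.EqOn r.integrand (fun z => (∏ i : Fin (k + 1), 2 / (1 + (z (Fin.natAdd (2 * N + 1) i)) ^ 2)) *
        (2 * z (Fin.natAdd (2 * N + 1) 0) /
          ((1 - ∏ i : Fin (2 * N + 1), z (Fin.castAdd (k + 1) i)) ^ 2 + (z (Fin.natAdd (2 * N + 1) 0)) ^ 2 * (1 + ∏ i : Fin (2 * N + 1), z (Fin.castAdd (k + 1) i)) ^ 2))) r.domain →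
      ∃ q : ℚ, ∀ (s : KZ.IntegralRep (2 * N + 1 + (k + 1))), s.domain = {x | ∀ i, x i ∈ Set.Ioo (0:ℝ) 1} →
        Set.EqOn s.integrand (fun x => (q : ℝ) * ∏ i, 2 / (1 + (x i) ^ 2)) s.domain →
        KZ.Equivalent r s := by
  intro N
  induction N with
  | zero =>
    exact uFamily_congr 1 (2 * 0 + 1) (by norm_num) (base_of_bottomCell hBot)
  | succ N ih =>
    exact uFamily_congr (2 * N + 1 + 2) (2 * (N + 1) + 1) (by ring) (step_odd hT hU hA1 (2 * N) ih)

end Engine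

end LadderDescentK2

open LadderDescent LadderDescentK2 in
/-- **S3, ladder descent** (registered stub of line `chebyshev-level-deformation`, proved). From the
engine S1, the arcs S2a and the bottom cell S2b: for cyclotomic half-angles `v₀ = tan(πj/L)` (`0 < j`,
`2j < L`) the Chebyshev box representations `[(0,1)^w, T(v₀, x₁⋯x_w)]` (`w ≥ 2` even) and
`[(0,1)^w, U(v₀, x₁⋯x_w)]` (`w ≥ 3` odd), and the level-1/2 representations `[(0,1)^w, 1/(1−t)]`,
`[(0,1)^w, 1/(1+t)]` (`w ≥ 2` even), are KZ-equivalent to RATIONAL multiples of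
`𝔭_w = [(0,1)^w, ∏ 2/(1+x_i²)]`. Proof: the odd ladder `LadderDescentK2.uFamily_odd` (induction on the
odd box dimension down to the bottom cell), then `ζ(even)` by the ladder at `v₀ = 1`
(`LadderDescent.step_zeta`), `[1/(1+t)]` by the level-4 dilation algebra (`LadderDescent.conc_inv`),
the T-boxes by the first T-step (`LadderDescent.conc_T`) and the U-boxes by the first U-step
(`LadderDescent.ladder_U0`) followed by one T-rung (`LadderDescent.step_T`).
[cite: KontsevichZagier2001, §1.2] -/
theorem stub_ladderDescent :
    -- S1 (engine), verbatim
    ((∀ (m k : ℕ) (D : Set (Fin k → ℝ)) (W lam : (Fin k → ℝ) → ℝ) (M Λ : ℝ),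
      Literature.ModelTheory.ExponentialFields.IsSemialgebraic ℚ D → Bornology.IsBounded D →
      IsSemialgebraicFunOn ℚ D W → IsSemialgebraicFunOn ℚ D lam →
      (∀ y ∈ D, |W y| ≤ M) → (∀ y ∈ D, 0 < lam y ∧ lam y ≤ Λ) →
      ∀ (r : KZ.IntegralRep (m + 2 + k)),
        r.domain = {z | (∀ i : Fin (m + 2), z (Fin.castAdd k i) ∈ Set.Ioo (0:ℝ) 1) ∧
          (fun j : Fin k => z (Fin.natAdd (m + 2) j)) ∈ D} →
        Set.EqOn r.integrand (fun z => W (fun j : Fin k => z (Fin.natAdd (m + 2) j)) *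
          (((1 - ∏ i : Fin (m + 2), z (Fin.castAdd k i)) -
              (lam (fun j : Fin k => z (Fin.natAdd (m + 2) j))) ^ 2 *
                (1 + ∏ i : Fin (m + 2), z (Fin.castAdd k i))) /
            ((1 - ∏ i : Fin (m + 2), z (Fin.castAdd k i)) ^ 2 +
              (lam (fun j : Fin k => z (Fin.natAdd (m + 2) j))) ^ 2 *
                (1 + ∏ i : Fin (m + 2), z (Fin.castAdd k i)) ^ 2))) r.domain →
        ∃ (r₁ : KZ.IntegralRep (m + 2 + k)) (r₂ : KZ.IntegralRep (m + 1 + (k + 1))),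
          r₁.domain = r.domain ∧
          (r₁.integrand = fun z => W (fun j : Fin k => z (Fin.natAdd (m + 2) j)) /
            (1 - ∏ i : Fin (m + 2), z (Fin.castAdd k i))) ∧
          r₂.domain = {z | (∀ i : Fin (m + 1), z (Fin.castAdd (k + 1) i) ∈ Set.Ioo (0:ℝ) 1) ∧
            (fun j : Fin k => z (Fin.natAdd (m + 1) j.succ)) ∈ D ∧
            0 < z (Fin.natAdd (m + 1) 0) ∧
            z (Fin.natAdd (m + 1) 0) < lam ((fun j : Fin k => z (Fin.natAdd (m + 1) j.succ)))} ∧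
          (r₂.integrand = fun z => W ((fun j : Fin k => z (Fin.natAdd (m + 1) j.succ))) *
            (2 / (1 + (z (Fin.natAdd (m + 1) 0)) ^ 2)) *
            (2 * z (Fin.natAdd (m + 1) 0) /
              ((1 - ∏ i : Fin (m + 1), z (Fin.castAdd (k + 1) i)) ^ 2 +
                (z (Fin.natAdd (m + 1) 0)) ^ 2 * (1 + ∏ i : Fin (m + 1), z (Fin.castAdd (k + 1) i)) ^ 2))) ∧
          KZ.of r - KZ.of r₁ + KZ.of r₂ ∈ KZ.relations) ∧
    (∀ (m k : ℕ) (D : Set (Fin k → ℝ)) (W lam : (Fin k → ℝ) → ℝ) (M Λ : ℝ),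
      Literature.ModelTheory.ExponentialFields.IsSemialgebraic ℚ D → Bornology.IsBounded D →
      IsSemialgebraicFunOn ℚ D W → IsSemialgebraicFunOn ℚ D lam →
      (∀ y ∈ D, |W y| ≤ M) → (∀ y ∈ D, 0 < lam y ∧ lam y ≤ Λ) →
      ∀ (r : KZ.IntegralRep (m + 2 + k)),
        r.domain = {z | (∀ i : Fin (m + 2), z (Fin.castAdd k i) ∈ Set.Ioo (0:ℝ) 1) ∧
          (fun j : Fin k => z (Fin.natAdd (m + 2) j)) ∈ D} →
        Set.EqOn r.integrand (fun z => W (fun j : Fin k => z (Fin.natAdd (m + 2) j)) *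
          (2 * lam (fun j : Fin k => z (Fin.natAdd (m + 2) j)) /
            ((1 - ∏ i : Fin (m + 2), z (Fin.castAdd k i)) ^ 2 +
              (lam (fun j : Fin k => z (Fin.natAdd (m + 2) j))) ^ 2 *
                (1 + ∏ i : Fin (m + 2), z (Fin.castAdd k i)) ^ 2))) r.domain →
        ∃ (r₂ : KZ.IntegralRep (m + 1 + (k + 1))),
          r₂.domain = {z | (∀ i : Fin (m + 1), z (Fin.castAdd (k + 1) i) ∈ Set.Ioo (0:ℝ) 1) ∧
            (fun j : Fin k => z (Fin.natAdd (m + 1) j.succ)) ∈ D ∧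
            0 < z (Fin.natAdd (m + 1) 0) ∧
            z (Fin.natAdd (m + 1) 0) < lam ((fun j : Fin k => z (Fin.natAdd (m + 1) j.succ)))} ∧
          (r₂.integrand = fun z => W ((fun j : Fin k => z (Fin.natAdd (m + 1) j.succ))) *
            (2 / (1 + (z (Fin.natAdd (m + 1) 0)) ^ 2)) *
            (((1 - ∏ i : Fin (m + 1), z (Fin.castAdd (k + 1) i)) -
                (z (Fin.natAdd (m + 1) 0)) ^ 2 * (1 + ∏ i : Fin (m + 1), z (Fin.castAdd (k + 1) i))) /
              ((1 - ∏ i : Fin (m + 1), z (Fin.castAdd (k + 1) i)) ^ 2 +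
                (z (Fin.natAdd (m + 1) 0)) ^ 2 * (1 + ∏ i : Fin (m + 1), z (Fin.castAdd (k + 1) i)) ^ 2))) ∧
          KZ.of r - KZ.of r₂ ∈ KZ.relations)) →
    -- S2a (arcs and chains), verbatim
    ((∀ (a j₀ j₁ L : ℕ), j₀ < j₁ → 2 * j₁ < L → ∀ (r : KZ.IntegralRep a),
      r.domain = {y | (∀ i, Real.tan (Real.pi * j₀ / L) < y i ∧ y i < Real.tan (Real.pi * j₁ / L)) ∧
        (∀ i i' : Fin a, i < i' → y i < y i')} →
      Set.EqOn r.integrand (fun y => ∏ i, 2 / (1 + (y i) ^ 2)) r.domain →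
      ∃ q : ℚ, ∀ (s : KZ.IntegralRep a), s.domain = {x | ∀ i, x i ∈ Set.Ioo (0:ℝ) 1} →
        Set.EqOn s.integrand (fun x => (q : ℝ) * ∏ i, 2 / (1 + (x i) ^ 2)) s.domain →
        KZ.Equivalent r s) ∧
    (∀ (r : KZ.IntegralRep 1), r.domain = {z | 0 < z 0} →
      Set.EqOn r.integrand (fun z => 1 / (1 + (z 0) ^ 2)) r.domain →
      ∀ (s : KZ.IntegralRep 1), s.domain = {x | ∀ i, x i ∈ Set.Ioo (0:ℝ) 1} →
        Set.EqOn s.integrand (fun x => ∏ i, 2 / (1 + (x i) ^ 2)) s.domain →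
        KZ.Equivalent r s)) →
    -- S2b (bottom cell), conclusion verbatim
    (∀ (k j L : ℕ), 0 < j → 2 * j < L → ∀ (r : KZ.IntegralRep (1 + (k + 1))),
      r.domain = {z | z (Fin.castAdd (k + 1) 0) ∈ Set.Ioo (0:ℝ) 1 ∧
        (∀ i : Fin (k + 1), 0 < z (Fin.natAdd 1 i) ∧ z (Fin.natAdd 1 i) < Real.tan (Real.pi * j / L)) ∧
        (∀ i i' : Fin (k + 1), i < i' → z (Fin.natAdd 1 i) < z (Fin.natAdd 1 i'))} →
      Set.EqOn r.integrand (fun z => (∏ i : Fin (k + 1), 2 / (1 + (z (Fin.natAdd 1 i)) ^ 2)) *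
        (2 * z (Fin.natAdd 1 0) /
          ((1 - z (Fin.castAdd (k + 1) 0)) ^ 2 +
            (z (Fin.natAdd 1 0)) ^ 2 * (1 + z (Fin.castAdd (k + 1) 0)) ^ 2))) r.domain →
      ∃ q : ℚ, ∀ (s : KZ.IntegralRep (1 + (k + 1))), s.domain = {x | ∀ i, x i ∈ Set.Ioo (0:ℝ) 1} →
        Set.EqOn s.integrand (fun x => (q : ℝ) * ∏ i, 2 / (1 + (x i) ^ 2)) s.domain →
        KZ.Equivalent r s) →
    -- conclusion: the four descents
    (∀ (w j L : ℕ), 2 ≤ w → Even w → 0 < j → 2 * j < L → ∀ (r : KZ.IntegralRep w),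
      r.domain = {x | ∀ i, x i ∈ Set.Ioo (0:ℝ) 1} →
      Set.EqOn r.integrand (fun x =>
        ((1 - ∏ i, x i) - (Real.tan (Real.pi * j / L)) ^ 2 * (1 + ∏ i, x i)) /
          ((1 - ∏ i, x i) ^ 2 + (Real.tan (Real.pi * j / L)) ^ 2 * (1 + ∏ i, x i) ^ 2)) r.domain →
      ∃ q : ℚ, ∀ (s : KZ.IntegralRep w), s.domain = {x | ∀ i, x i ∈ Set.Ioo (0:ℝ) 1} →
        Set.EqOn s.integrand (fun x => (q : ℝ) * ∏ i, 2 / (1 + (x i) ^ 2)) s.domain →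
        KZ.Equivalent r s) ∧
    (∀ (w j L : ℕ), 3 ≤ w → Odd w → 0 < j → 2 * j < L → ∀ (r : KZ.IntegralRep w),
      r.domain = {x | ∀ i, x i ∈ Set.Ioo (0:ℝ) 1} →
      Set.EqOn r.integrand (fun x =>
        2 * Real.tan (Real.pi * j / L) /
          ((1 - ∏ i, x i) ^ 2 + (Real.tan (Real.pi * j / L)) ^ 2 * (1 + ∏ i, x i) ^ 2)) r.domain →
      ∃ q : ℚ, ∀ (s : KZ.IntegralRep w), s.domain = {x | ∀ i, x i ∈ Set.Ioo (0:ℝ) 1} →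
        Set.EqOn s.integrand (fun x => (q : ℝ) * ∏ i, 2 / (1 + (x i) ^ 2)) s.domain →
        KZ.Equivalent r s) ∧
    (∀ (w : ℕ), 2 ≤ w → Even w → ∀ (r : KZ.IntegralRep w),
      r.domain = {x | ∀ i, x i ∈ Set.Ioo (0:ℝ) 1} →
      Set.EqOn r.integrand (fun x => 1 / (1 - ∏ i, x i)) r.domain →
      ∃ q : ℚ, ∀ (s : KZ.IntegralRep w), s.domain = {x | ∀ i, x i ∈ Set.Ioo (0:ℝ) 1} →
        Set.EqOn s.integrand (fun x => (q : ℝ) * ∏ i, 2 / (1 + (x i) ^ 2)) s.domain →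
        KZ.Equivalent r s) ∧
    (∀ (w : ℕ), 2 ≤ w → Even w → ∀ (r : KZ.IntegralRep w),
      r.domain = {x | ∀ i, x i ∈ Set.Ioo (0:ℝ) 1} →
      Set.EqOn r.integrand (fun x => 1 / (1 + ∏ i, x i)) r.domain →
      ∃ q : ℚ, ∀ (s : KZ.IntegralRep w), s.domain = {x | ∀ i, x i ∈ Set.Ioo (0:ℝ) 1} →
        Set.EqOn s.integrand (fun x => (q : ℝ) * ∏ i, 2 / (1 + (x i) ^ 2)) s.domain →
        KZ.Equivalent r s) := by
  rintro ⟨hT, hU⟩ ⟨hA1, -⟩ hBot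
  have hOdd := uFamily_odd hT hU hA1 hBot
  have hC3 : ∀ (w : ℕ), 2 ≤ w → Even w → ∀ (r : KZ.IntegralRep w),
      r.domain = {x | ∀ i, x i ∈ Set.Ioo (0:ℝ) 1} →
      Set.EqOn r.integrand (fun x => 1 / (1 - ∏ i, x i)) r.domain →
      ∃ q : ℚ, ∀ (s : KZ.IntegralRep w), s.domain = {x | ∀ i, x i ∈ Set.Ioo (0:ℝ) 1} →
        Set.EqOn s.integrand (fun x => (q : ℝ) * ∏ i, 2 / (1 + (x i) ^ 2)) s.domain →
        KZ.Equivalent r s := by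
    intro w hw hev
    obtain ⟨N, rfl⟩ : ∃ N, w = 2 * N + 2 := by
      obtain ⟨c, hc⟩ := hev
      exact ⟨c - 1, by omega⟩
    exact step_zeta hT (2 * N) (hOdd N)
  refine ⟨?_, ?_, hC3, fun w hw hev => conc_inv w hw (hC3 w hw hev)⟩
  · intro w j L hw hev hj hjL
    obtain ⟨N, rfl⟩ : ∃ N, w = 2 * N + 2 := by
      obtain ⟨c, hc⟩ := hev
      exact ⟨c - 1, by omega⟩
    exact conc_T hT (2 * N) (hC3 (2 * N + 2) hw ⟨N + 1, by ring⟩) (hOdd N) j L hj hjL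
  · intro w j L hw hodd hj hjL r hdom hint
    obtain ⟨N, rfl⟩ : ∃ N, w = 2 * N + 1 + 2 := by
      obtain ⟨c, hc⟩ := hodd
      exact ⟨c - 1, by omega⟩
    obtain ⟨r₂, h2d, h2i, hrel⟩ := ladder_U0 hU (2 * N + 1) j L hj hjL r hdom hint
    have hTT := tFamily_congr (2 * N + 2) (2 * N + 1 + 1) rfl
      (step_T hT hA1 (2 * N) (hC3 (2 * N + 2) (by omega) ⟨N + 1, by ring⟩) (hOdd N))
    exact inQP_cast (by omega)
      (inQP_of_equivalent (show KZ.Equivalent r r₂ from hrel) (hTT 0 j L hj hjL r₂ h2d h2i))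

/-- **Registered sub-goal `ladderDescent_uDescent`** (line `chebyshev-level-deformation`, stub S3): the U-step of
the descent with the LANDED engine `stub_ladderEngine` — `𝔘_{m+2,·} ∈ ℚ·𝔭 ⇐ 𝔗_{m+1,·} ∈ ℚ·𝔭`. [cite: KontsevichZagier2001, §1.2] -/
theorem ladderDescent_uDescent : ∀ (m : ℕ), (∀ (k j L : ℕ), 0 < j → 2 * j < L → ∀ (r : KZ.IntegralRep (m + 1 + (k + 1))), r.domain = {z | (∀ i : Fin (m + 1), z (Fin.castAdd (k + 1) i) ∈ Set.Ioo (0:ℝ) 1) ∧ (∀ i : Fin (k + 1), 0 < z (Fin.natAdd (m + 1) i) ∧ z (Fin.natAdd (m + 1) i) < Real.tan (Real.pi * j / L)) ∧ (∀ i i' : Fin (k + 1), i < i' → z (Fin.natAdd (m + 1) i) < z (Fin.natAdd (m + 1) i'))} → Set.EqOn r.integrand (fun z => (∏ i : Fin (k + 1), 2 / (1 + (z (Fin.natAdd (m + 1) i)) ^ 2)) * (((1 - ∏ i : Fin (m + 1), z (Fin.castAdd (k + 1) i)) - (z (Fin.natAdd (m + 1) 0)) ^ 2 * (1 + ∏ i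 : Fin (m + 1), z (Fin.castAdd (k + 1) i))) / ((1 - ∏ i : Fin (m + 1), z (Fin.castAdd (k + 1) i)) ^ 2 + (z (Fin.natAdd (m + 1) 0)) ^ 2 * (1 + ∏ i : Fin (m + 1), z (Fin.castAdd (k + 1) i)) ^ 2))) r.domain → ∃ q : ℚ, ∀ (s : KZ.IntegralRep (m + 1 + (k + 1))), s.domain = {x | ∀ i, x i ∈ Set.Ioo (0:ℝ) 1} → Set.EqOn s.integrand (fun x => (q : ℝ) * ∏ i, 2 / (1 + (x i) ^ 2)) s.domain → KZ.Equivalent r s) → ∀ (k j L : ℕ), 0 < j → 2 * j < L → ∀ (r : KZ.IntegralRep (m + 2 + (k + 1))), r.domain = {z | (∀ i : Fin (m + 2), z (Fin.castAdd (k + 1) i) ∈ Set.Ioo (0:ℝ) 1) ∧ (∀ i : Fin (k + 1), 0 < z (Fin.natAdd (m + 2) i) ∧ z (Fin.natAdd (m + 2) i) < Real.tan (Real.pi * j / L)) ∧ (∀ i i' : Fin (k + 1), i < i' → z (Fin.natAdd (m + 2) i) < z (Fin.natAdd (m + 2) i'))} → Set.EqOn r.integrand (fun z => (∏ i : Fin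 (k + 1), 2 / (1 + (z (Fin.natAdd (m + 2) i)) ^ 2)) * (2 * z (Fin.natAdd (m + 2) 0) / ((1 - ∏ i : Fin (m + 2), z (Fin.castAdd (k + 1) i)) ^ 2 + (z (Fin.natAdd (m + 2) 0)) ^ 2 * (1 + ∏ i : Fin (m + 2), z (Fin.castAdd (k + 1) i)) ^ 2))) r.domain → ∃ q : ℚ, ∀ (s : KZ.IntegralRep (m + 2 + (k + 1))), s.domain = {x | ∀ i, x i ∈ Set.Ioo (0:ℝ) 1} → Set.EqOn s.integrand (fun x => (q : ℝ) * ∏ i, 2 / (1 + (x i) ^ 2)) s.domain → KZ.Equivalent r s :=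
  fun m => LadderDescentK2.step_U stub_ladderEngine.2 m

end Summit.KontsevichZagierPeriods.Theorems.HurwitzMicroSectorsHurwitzSectorComplement

end
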